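import Summits.ResolutionOfSingularities.ResolutionOfSingularities.Theorems.WildConesCampaignW46ForcedAtomFibreCount
import Summits.ResolutionOfSingularities.ResolutionOfSingularities.Theorems.WildConesCampaignW46ForcedAtomChartDatumRat
import HarnessLib

/-!
# [OURS · L1 W4.6, rung (i) — the dictionary, SCHEME HALF, brick 37 = brick 31 in RATIONAL FORM] Counting the singular
# points of the transform over a blown-up forced-atom point, `K` perfect, the points RATIONAL relative to the blow-up
# (hypothesis `hrat`) — for the finite-field / `K`-rational variants of the finite-`Sing` forced-atom rung

Cell res-hironaka (LADDER-RESOLUTION rung L, D-0089), slot W4.6 «restricted regimes as rungs», seat res-L1-s46-pv-2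
(gen 5: the GEOMETRIC upgrade of the forced-atom rung — finitely many singular points instead of one). Host: route
`WildCones`, crux `ClassicalRegimes` (stmt-ResolutionOfSingularities-16884), `--supports … --as helper`.

RATIONAL FORM (gen 5, after brick 31 p551188): verbatim brick 31 with `[IsAlgClosed K]` replaced by `[PerfectField K]`, the
closedness of the points replaced by their relative rationality `hrat` (brick 36). Names carry the suffix `_rat`; the
field-free helpers (`step_update_self`, `constantCoeff_presentation_eq_zero_iff`, `ne_zero_of_adapted`) are brick 31's.

HONEST FRAMING. Everything here is OURS: bookkeeping over this seat's dictionary bricks 27 (`ChartPoint.eq_of_chartData_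
congr`: a point over `ξ` is determined by chart index + congruent residues), 30 (`ForcedAtom.exists_canonical_chartDatum_
of_eq`: the canonical chart datum of a singular point of the transform) and 8–13 (the one step), over the tree's blow-up
library and route `WildCones`' typed calculus (`step`, `Isol`, `MultP`). NOTHING here is a statement of H. Hironaka's
manuscript [Hironaka2017] and nothing of it is used; no FACT-LIST premise. AI review is weaker than expert review.

## What is proved

* `exists_presentation_transform_of_eq_rat` — the ONE STEP of brick 13 / p523688 with the centre read as `π ξ′ = ξ` (no
  «`Sing(E)` subsingleton» hypothesis): at a closed `ξ′ ∈ Sing(E′)` over the forced-atom point `ξ`, `J′_{ξ′}` is presented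
  by a unit times a successor atom `z^p − ser (step i₀ t a)`.
* `card_fibre_le_of_calculusBound_rat` — **THE FIBRE COUNT.** `K` perfect, `0 < n`; `π : Z′ → Z` the blow-up of
  an ambient datum at `D = {ξ}` over the same base field, `E = (J, p)`, `ξ` a forced-atom point with presentation
  `(E₀, f₀, a, w)`, `MultP a`, `ser a ∈ 𝔪^(p+1)`; suppose every point of `Sing(E′)` is closed and every presentation
  there is `Isol` and every point of `Sing(E′)` is rational relative to `π` (the regime at the next stage). If every finite set of CANONICAL calculus data `(i, t)` (`t_l = 0` for
  `l ≤ i`) with `step i t a` isolated of multiplicity `p` has at most `B` elements, then **every finite set of points of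
  `Sing(E′)` over `ξ` has at most `B` elements**: the map «point ↦ canonical chart datum» (brick 30) lands in such data
  (multiplicity `p` from `ξ′ ∈ Sing(E′)` through the dictionary, isolatedness from the regime, canonicity from the
  smallest chart and the vanishing coordinates) and is INJECTIVE (brick 27, the `z`-residues vanishing by brick 28).
  With brick 29 (`B = 3` for surfaces) this is the branching bound of the finite-`Sing` forced-atom rung.

References: this seat's bricks 8–13, 27–30; H. Hironaka, ms. 2017, Th. 16.6 p.84 — ROLE of «the closed points
`ξ′ ∈ π⁻¹(ξ)` at which the transform has order `≥ b`» only, under adjudication, not cited as fact. [folklore]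
-/

noncomputable section

-- single-problem summit: the doubled namespace component `ResolutionOfSingularities` is forced
set_option linter.dupNamespace false

open scoped BigOperators Classical
open MvPowerSeries IsLocalRing

namespace Summit.ResolutionOfSingularities.ResolutionOfSingularities.Theorems

namespace CampaignW46.ForcedAtom

open CategoryTheory AlgebraicGeometry TopologicalSpace
open Literature.AlgebraicGeometry.Resolution
open Literature.AlgebraicGeometry.Hironaka2017.S02Preliminaries
open Literature.AlgebraicGeometry.Hironaka2017.Datum
open Scheme.IdealSheafData
open WildCones
open CampaignW46.ChartPoint CampaignW46.AtomGerm CampaignW46.FormalChart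
open Literature.RingTheory.MvPowerSeries.Jets (mem_maximalIdeal_iff_constantCoeff_eq_zero
  coeff_eq_zero_of_mem_maximalIdeal_pow)

variable {p : ℕ} [Fact p.Prime] {K : Type} [Field K] [CharP K p] {n : ℕ}

variable [PerfectField K]

/-! ## The one step with the centre read as `π ξ′ = ξ` -/

/-- [OURS · L1 W4.6 — the ONE STEP in the forced-atom class for raw blow-up data, centre read as `π ξ′ = ξ`; replaces the
role of «the transform `E′` of `E` by the blowup with center `D`» (H. Hironaka, ms. 2017, Def. 2.1 p.5) at an isolated
`p`-fold point presented by a height-one atom; NOT a statement of the manuscript] As brick 13's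
`exists_presentation_transform_of_isBlowup` (p523688) without the hypothesis «`Sing(E)` is a subsingleton»: the centre is
`{π ξ′}` and `ξ′ ∈ Sing(E′)` is closed. [folklore] -/
theorem exists_presentation_transform_of_eq_rat {A A' : AmbientDatum p K} (π : A'.Z ⟶ A.Z) (D : Closeds A.Z)
    (hπ : IsBlowup π (vanishingIdeal D)) {E : IdealExponent A.Z} (hb : E.b = p)
    {ξ' : A'.Z} (hD : (D : Set A.Z) = {π ξ'})
    (hd : (maximalIdeal (A.Z.presheaf.stalk (π ξ'))).spanFinrank = n + 1)
    (E₀ : AdicCompletion (maximalIdeal (A.Z.presheaf.stalk (π ξ'))) (A.Z.presheaf.stalk (π ξ')) ≃+*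
      MvPowerSeries (Option (Fin n)) K)
    (f₀ : A.Z.presheaf.stalk (π ξ')) (a : (Fin n → ℕ) → K) (w : MvPowerSeries (Option (Fin n)) K)
    (hJ : stalkIdeal E.J (π ξ') = Ideal.span {f₀}) (hw : IsUnit w)
    (hf₀ : E₀ (algebraMap _ _ f₀) =
      w * ((X none : MvPowerSeries (Option (Fin n)) K) ^ p - rename (some : Fin n → Option (Fin n)) (ser p n K a)))
    (hM : MultP p n K a) (hξ' : ξ' ∈ (E.transform π D).sing)
    (hrat : ∀ y : A'.Z.presheaf.stalk ξ', ∃ r : A.Z.presheaf.stalk (π ξ'),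
      y - (π.stalkMap ξ').hom r ∈ maximalIdeal (A'.Z.presheaf.stalk ξ')) :
    ∃ (i₀ : Fin n) (t : Fin n → K)
      (E₀' : AdicCompletion (maximalIdeal (A'.Z.presheaf.stalk ξ')) (A'.Z.presheaf.stalk ξ') ≃+*
        MvPowerSeries (Option (Fin n)) K)
      (f₀' : A'.Z.presheaf.stalk ξ') (w' : MvPowerSeries (Option (Fin n)) K),
      stalkIdeal (E.transform π D).J ξ' = Ideal.span {f₀'} ∧ IsUnit w' ∧
        E₀' (algebraMap _ _ f₀') =
          w' * ((X none : MvPowerSeries (Option (Fin n)) K) ^ p -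
            rename (some : Fin n → Option (Fin n)) (ser p n K (step p n K i₀ t a))) := by
  -- an adapted system of parameters and the canonical datum (brick 30) when `ord a ≥ p + 1`; in general we only need
  -- some `u`-chart, which brick 13's proof provides verbatim — we re-run it through brick 30's interface when possible
  -- and fall back to the direct argument otherwise. Direct argument:
  haveI : IsLocallyNoetherian A'.Z := ambient_isLocallyNoetherian A'
  have hp : p.Prime := Fact.out
  haveI : IsRegularLocalRing (A.Z.presheaf.stalk (π ξ')) := ambient_isRegular A _
  haveI : IsRegularLocalRing (A'.Z.presheaf.stalk ξ') := ambient_isRegular A' _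
  have hloc : IsLocalHom (π.stalkMap ξ').hom := inferInstance
  have hg : (maximalIdeal (A.Z.presheaf.stalk (π ξ'))).map (π.stalkMap ξ').hom ≤
      maximalIdeal (A'.Z.presheaf.stalk ξ') :=
    ((IsLocalRing.local_hom_TFAE (π.stalkMap ξ').hom).out 0 2).mp hloc
  obtain ⟨c, hc, hcX⟩ := exists_rsop_adapted E₀
  have hcl : IsClosed ({π ξ'} : Set A.Z) := hD ▸ D.isClosed
  have hcJ : Ideal.span (Set.range c) = stalkIdeal (vanishingIdeal D) (π ξ') := by
    rw [hc, stalkIdeal_vanishingIdeal_eq_maximalIdeal_of_closure_eq]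
    rw [hD, hcl.closure_eq]
  have hd' : (maximalIdeal (A.Z.presheaf.stalk (π ξ'))).spanFinrank = Fintype.card (Option (Fin n)) := by
    rw [hd, Fintype.card_option, Fintype.card_fin]
  obtain ⟨i, e, τ, he, hei, hnzd, hgen, -, hdim⟩ := exists_stalk_chartData_nzd hπ ξ' c hcJ hc hd' hrat
  have hf₀𝔪 : f₀ ∈ maximalIdeal (A.Z.presheaf.stalk (π ξ')) ^ p := by
    rw [mem_maximalIdeal_pow_iff_of_ringEquiv E₀ hw hf₀ p]
    exact ((multP_iff_atom_mem a).1 hM).2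
  -- the conclusion from chart data with a `u`-index
  have tail : ∀ (i₀ : Fin n) (e : Option (Fin n) → A'.Z.presheaf.stalk ξ')
      (τ : Option (Fin n) → A.Z.presheaf.stalk (π ξ')),
      (∀ j, (π.stalkMap ξ').hom (c j) = (π.stalkMap ξ').hom (c (some i₀)) * e j) →
      (π.stalkMap ξ').hom (c (some i₀)) ∈ nonZeroDivisors (A'.Z.presheaf.stalk ξ') →
      Ideal.span (Set.range fun j : Option (Fin n) => if j = some i₀ then (π.stalkMap ξ').hom (c (some i₀))
        else e j - (π.stalkMap ξ').hom (τ j)) = maximalIdeal (A'.Z.presheaf.stalk ξ') →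
      ∃ (i₀ : Fin n) (t : Fin n → K)
        (E₀' : AdicCompletion (maximalIdeal (A'.Z.presheaf.stalk ξ')) (A'.Z.presheaf.stalk ξ') ≃+*
          MvPowerSeries (Option (Fin n)) K)
        (f₀' : A'.Z.presheaf.stalk ξ') (w' : MvPowerSeries (Option (Fin n)) K),
        stalkIdeal (E.transform π D).J ξ' = Ideal.span {f₀'} ∧ IsUnit w' ∧
          E₀' (algebraMap _ _ f₀') =
            w' * ((X none : MvPowerSeries (Option (Fin n)) K) ^ p -
              rename (some : Fin n → Option (Fin n)) (ser p n K (step p n K i₀ t a))) := by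
    intro i₀ e τ he hnzd hgen
    obtain ⟨f', hf'⟩ := exists_eq_pow_mul_of_mem_pow (π.stalkMap ξ').hom c hc (some i₀) e he hf₀𝔪
    have hJ' : stalkIdeal (E.transform π D).J ξ' = Ideal.span {f'} :=
      stalkIdeal_transform_eq_span hπ ξ' c hcJ (some i₀) e he hnzd E f₀ hJ f' (by rw [hb]; exact hf')
    have hf'𝔪 : f' ∈ maximalIdeal (A'.Z.presheaf.stalk ξ') := by
      have h := (mem_sing_transform_iff E ξ' f' hJ').mp hξ'
      rw [hb] at h
      exact Ideal.pow_le_self hp.ne_zero h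
    obtain ⟨E', w', hw', -, hE'⟩ := exists_ringEquiv_transform_atom (π.stalkMap ξ').hom hg E₀ c hc hcX i₀ e he τ
      hgen hrat hdim a hM f₀ w hw hf₀ f' hf' hf'𝔪
    exact ⟨i₀, _, E', f', w', hJ', hw', hE'⟩
  cases i with
  | some i₀ => exact tail i₀ e τ he hnzd hgen
  | none =>
    obtain ⟨f', hf'⟩ := exists_eq_pow_mul_of_mem_pow (π.stalkMap ξ').hom c hc none e he hf₀𝔪
    have hJ' : stalkIdeal (E.transform π D).J ξ' = Ideal.span {f'} :=
      stalkIdeal_transform_eq_span hπ ξ' c hcJ none e he hnzd E f₀ hJ f' (by rw [hb]; exact hf')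
    have hf'𝔪 : f' ∈ maximalIdeal (A'.Z.presheaf.stalk ξ') := by
      have h := (mem_sing_transform_iff E ξ' f' hJ').mp hξ'
      rw [hb] at h
      exact Ideal.pow_le_self hp.ne_zero h
    by_cases hτ : ∀ j : Fin n, τ (some j) ∈ maximalIdeal (A.Z.presheaf.stalk (π ξ'))
    · exact absurd hf'𝔪 (not_mem_maximalIdeal_transform_of_zChart (π.stalkMap ξ').hom hg E₀ c hc hcX e he τ
        hgen hrat hdim hτ a hM f₀ w hw hf₀ f' hf')
    · simp only [not_forall] at hτ
      obtain ⟨j₀, hj₀⟩ := hτ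
      have hu : IsUnit (τ (some j₀)) := (IsLocalRing.notMem_maximalIdeal).mp hj₀
      obtain ⟨e', τ', he', -, hgen'⟩ := exists_chartData_reindex (π.stalkMap ξ').hom c none e he hei τ hgen
        (some j₀) (Option.some_ne_none j₀) hu
      have hej₀ : IsUnit (e (some j₀)) := by
        refine isUnit_of_sub_mem_maximalIdeal (hu.map (π.stalkMap ξ').hom) ?_
        rw [← hgen]
        exact Ideal.subset_span ⟨some j₀, by dsimp only; rw [if_neg (Option.some_ne_none j₀)]⟩
      have hnzd' : (π.stalkMap ξ').hom (c (some j₀)) ∈ nonZeroDivisors (A'.Z.presheaf.stalk ξ') := by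
        rw [he (some j₀)]
        exact mul_mem hnzd hej₀.mem_nonZeroDivisors
      exact tail j₀ e' τ' he' hnzd' hgen'

/-! ## The fibre count -/

/-- [OURS · L1 W4.6 — DICTIONARY, THE FIBRE COUNT; replaces the role of a bound on «the closed points `ξ′ ∈ π⁻¹(ξ)` at
which the transform has order `≥ b`» (H. Hironaka, ms. 2017, Th. 16.6 p.84 l.10) over a forced-atom point, by a bound on
the canonical data of the `WildCones` calculus; NOT a statement of the manuscript] See the module docstring. [folklore] -/
theorem card_fibre_le_of_calculusBound_rat (hn : 0 < n) {A A' : AmbientDatum p K} (π : A'.Z ⟶ A.Z) (D : Closeds A.Z)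
    (hπ : IsBlowup π (vanishingIdeal D)) {E : IdealExponent A.Z} (hb : E.b = p)
    {ξ : A.Z} (hD : (D : Set A.Z) = {ξ}) (hd : (maximalIdeal (A.Z.presheaf.stalk ξ)).spanFinrank = n + 1)
    (E₀ : AdicCompletion (maximalIdeal (A.Z.presheaf.stalk ξ)) (A.Z.presheaf.stalk ξ) ≃+*
      MvPowerSeries (Option (Fin n)) K)
    (f₀ : A.Z.presheaf.stalk ξ) (a : (Fin n → ℕ) → K) (w : MvPowerSeries (Option (Fin n)) K)
    (hJ : stalkIdeal E.J ξ = Ideal.span {f₀}) (hw : IsUnit w)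
    (hf₀ : E₀ (algebraMap _ _ f₀) =
      w * ((X none : MvPowerSeries (Option (Fin n)) K) ^ p - rename (some : Fin n → Option (Fin n)) (ser p n K a)))
    (hM : MultP p n K a) (hord : ser p n K a ∈ maximalIdeal (MvPowerSeries (Fin n) K) ^ (p + 1))
    (hiso' : ∀ ξ' ∈ (E.transform π D).sing,
      (∀ y : A'.Z.presheaf.stalk ξ', ∃ r : A.Z.presheaf.stalk (π ξ'),
        y - (π.stalkMap ξ').hom r ∈ maximalIdeal (A'.Z.presheaf.stalk ξ')) ∧
      ∀ (E₀' : AdicCompletion (maximalIdeal (A'.Z.presheaf.stalk ξ')) (A'.Z.presheaf.stalk ξ') ≃+*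
          MvPowerSeries (Option (Fin n)) K)
        (f₀' : A'.Z.presheaf.stalk ξ') (c' : (Fin n → ℕ) → K) (w' : MvPowerSeries (Option (Fin n)) K),
        stalkIdeal (E.transform π D).J ξ' = Ideal.span {f₀'} → IsUnit w' →
          E₀' (algebraMap _ _ f₀') = w' * ((X none : MvPowerSeries (Option (Fin n)) K) ^ p -
            rename (some : Fin n → Option (Fin n)) (ser p n K c')) → Isol p n K c')
    (B : ℕ) (hB : ∀ T : Finset (Fin n × (Fin n → K)),
      (∀ d ∈ T, Isol p n K (step p n K d.1 d.2 a) ∧ MultP p n K (step p n K d.1 d.2 a) ∧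
        ∀ l : Fin n, l ≤ d.1 → d.2 l = 0) → T.card ≤ B)
    (t : Finset A'.Z) (ht : ∀ ξ' ∈ t, ξ' ∈ (E.transform π D).sing ∧ π ξ' = ξ) :
    t.card ≤ B := by
  haveI : IsIntegral A.Z := ambient_isIntegral A
  haveI : IsIntegral A'.Z := ambient_isIntegral A'
  haveI : IsLocallyNoetherian A.Z := ambient_isLocallyNoetherian A
  haveI : IsLocallyNoetherian A'.Z := ambient_isLocallyNoetherian A'
  have hp : p.Prime := Fact.out
  haveI : IsRegularLocalRing (A.Z.presheaf.stalk ξ) := ambient_isRegular A _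
  -- a fixed adapted system of parameters at `ξ`
  obtain ⟨c, hc, hcX⟩ := exists_rsop_adapted E₀
  have hcl : IsClosed ({ξ} : Set A.Z) := hD ▸ D.isClosed
  have hJD : stalkIdeal (vanishingIdeal D) ξ = maximalIdeal (A.Z.presheaf.stalk ξ) := by
    rw [stalkIdeal_vanishingIdeal_eq_maximalIdeal_of_closure_eq]
    rw [hD, hcl.closure_eq]
  -- the canonical chart datum of every singular point over `ξ` (brick 30)
  have hdat := fun (ξ' : A'.Z) (hξ' : ξ' ∈ (E.transform π D).sing) (h : π ξ' = ξ) =>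
    exists_canonical_chartDatum_of_eq_rat π D hπ hb hD hd E₀ c hc hcX f₀ a w hJ hw hf₀ hM hord h hξ' (hiso' ξ' hξ').1
  choose I e τ E₀' f₀' w' hI using hdat
  -- the datum map, normalised at the chart coordinate
  let Φ : A'.Z → Fin n × (Fin n → K) := fun ξ' =>
    if h : ξ' ∈ (E.transform π D).sing ∧ π ξ' = ξ then
      (I ξ' h.1 h.2, Function.update (fun l => constantCoeff (E₀ (algebraMap _ _ (τ ξ' h.1 h.2 (some l))))) (I ξ' h.1 h.2) 0)
    else (⟨0, hn⟩, 0)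
  have hΦ : ∀ ξ' (h : ξ' ∈ (E.transform π D).sing ∧ π ξ' = ξ), Φ ξ' =
      (I ξ' h.1 h.2, Function.update (fun l => constantCoeff (E₀ (algebraMap _ _ (τ ξ' h.1 h.2 (some l)))))
        (I ξ' h.1 h.2) 0) := fun ξ' h => dif_pos h
  -- (1) the data of the points of `t` are canonical forced data
  have himage : ∀ d ∈ t.image Φ, Isol p n K (step p n K d.1 d.2 a) ∧ MultP p n K (step p n K d.1 d.2 a) ∧
      ∀ l : Fin n, l ≤ d.1 → d.2 l = 0 := by
    intro d hd
    obtain ⟨ξ', hξ't, rfl⟩ := Finset.mem_image.mp hd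
    have h := ht ξ' hξ't
    obtain ⟨he', hres, hτnone, hcanon, hJ', hw'', hE'⟩ := hI ξ' h.1 h.2
    haveI : IsRegularLocalRing (A'.Z.presheaf.stalk ξ') := ambient_isRegular A' _
    rw [hΦ ξ' h]
    try dsimp only
    rw [step_update_self]
    have hIsol : Isol p n K (step p n K (I ξ' h.1 h.2)
        (fun l => constantCoeff (E₀ (algebraMap _ _ (τ ξ' h.1 h.2 (some l))))) a) :=
      (hiso' ξ' h.1).2 _ _ _ _ hJ' hw'' hE'
    refine ⟨hIsol, ?_, fun l hl => ?_⟩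
    · -- multiplicity `p` from `ξ′ ∈ Sing(E′)` through the presentation
      have hf'𝔪 : f₀' ξ' h.1 h.2 ∈ maximalIdeal (A'.Z.presheaf.stalk ξ') ^ p := by
        have h1 := h.1
        change ((E.transform π D).b : ℕ∞) ≤ idealOrder (E.transform π D).J _ at h1
        rw [le_idealOrder_iff, hJ', Ideal.span_singleton_le_iff_mem] at h1
        have hb' : (E.transform π D).b = p := hb
        rw [hb'] at h1
        exact h1
      exact (transform_mem_pow_iff_multP (E₀' ξ' h.1 h.2) hw'' _ hE').2.mpr
        ⟨ThreefoldsCharTwo.ser_ne_zero_of_isol hn hIsol, hf'𝔪⟩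
    · rcases hl.lt_or_eq with hlt | rfl
      · rw [Function.update_of_ne (ne_of_lt hlt)]
        exact (constantCoeff_presentation_eq_zero_iff E₀ _).2 (hcanon l hlt)
      · exact Function.update_self _ _ _
  -- (2) the datum map is injective on `t` (bricks 27, 28)
  have hinj : Set.InjOn Φ t := by
    intro ξ₁ hξ₁ ξ₂ hξ₂ heq
    have h₁ := ht ξ₁ hξ₁
    have h₂ := ht ξ₂ hξ₂
    rw [hΦ ξ₁ h₁, hΦ ξ₂ h₂, Prod.mk.injEq] at heq
    obtain ⟨hI12, ht12⟩ := heq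
    obtain ⟨he₁, hres₁, hτnone₁, -, -⟩ := hI ξ₁ h₁.1 h₁.2
    obtain ⟨he₂, hres₂, hτnone₂, -, -⟩ := hI ξ₂ h₂.1 h₂.2
    set i₀ := I ξ₁ h₁.1 h₁.2 with hi₀
    -- normalise the data at the chart index `some i₀` (quotient `1`, lift `1`)
    refine eq_of_chartData_congr hπ hJD h₁.2 h₂.2
      ((π.stalkMap ξ₁).hom.comp (A.Z.presheaf.stalkSpecializes (specializes_of_apply_eq ξ h₁.2).1).hom)
      ((π.stalkMap ξ₂).hom.comp (A.Z.presheaf.stalkSpecializes (specializes_of_apply_eq ξ h₂.2).1).hom)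
      (fun r => stalkEmb_stalkMap_stalkSpecializes hπ h₁.2 r) (fun r => stalkEmb_stalkMap_stalkSpecializes hπ h₂.2 r)
      c hc (some i₀) (ne_zero_of_adapted E₀ hcX (some i₀))
      (Function.update (e ξ₁ h₁.1 h₁.2) (some i₀) 1) (Function.update (e ξ₂ h₂.1 h₂.2) (some i₀) 1)
      (fun j => ?_) (fun j => ?_)
      (Function.update (τ ξ₁ h₁.1 h₁.2) (some i₀) 1) (Function.update (τ ξ₂ h₂.1 h₂.2) (some i₀) 1)
      (fun j => ?_) (fun j => ?_) (fun j => ?_)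
    · by_cases hj : j = some i₀
      · subst hj; rw [Function.update_self, mul_one]
      · rw [Function.update_of_ne hj, RingHom.comp_apply, RingHom.comp_apply]; exact he₁ j
    · by_cases hj : j = some i₀
      · subst hj; rw [Function.update_self, mul_one]
      · rw [Function.update_of_ne hj, RingHom.comp_apply, RingHom.comp_apply, hI12]; exact he₂ j
    · -- congruent lifts
      by_cases hj : j = some i₀
      · subst hj; rw [Function.update_self, Function.update_self, sub_self]; exact zero_mem _
      · rw [Function.update_of_ne hj, Function.update_of_ne hj]
        cases j with
        | none => exact sub_mem hτnone₁ hτnone₂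
        | some l =>
          have hl : l ≠ i₀ := fun h => hj (congrArg some h)
          have hl' : l ≠ I ξ₂ h₂.1 h₂.2 := by rw [← hI12]; exact hl
          have htl := congrFun ht12 l
          rw [Function.update_of_ne hl, Function.update_of_ne hl'] at htl
          refine (constantCoeff_presentation_eq_zero_iff E₀ _).1 ?_
          rw [map_sub, map_sub, map_sub, htl, sub_self]
    · by_cases hj : j = some i₀
      · subst hj; rw [Function.update_self, Function.update_self, map_one, sub_self]; exact zero_mem _
      · rw [Function.update_of_ne hj, Function.update_of_ne hj, RingHom.comp_apply]; exact hres₁ j hj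
    · by_cases hj : j = some i₀
      · subst hj; rw [Function.update_self, Function.update_self, map_one, sub_self]; exact zero_mem _
      · rw [Function.update_of_ne hj, Function.update_of_ne hj, RingHom.comp_apply]
        exact hres₂ j (by rw [← hI12]; exact hj)
  -- (3) count
  rw [← Finset.card_image_of_injOn hinj]
  exact hB _ himage

end CampaignW46.ForcedAtom

end Summit.ResolutionOfSingularities.ResolutionOfSingularities.Theorems

end
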